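import Mathlib.NumberTheory.LegendreSymbol.JacobiSymbol
import Mathlib.NumberTheory.LegendreSymbol.QuadraticReciprocity
import Mathlib.Analysis.PSeries
import Literature.Barriers.Parity.SiegelZeroQuadraticPolynomials
import Literature.NumberTheory.Sieve.BatemanHornProofs
import Literature.NumberTheory.LFunctions.MertensFormula
import HarnessLib

/-!
# Tools for Granville–Mollin's Proposition 2: `ω_{f_d}(p) = 1 + (p/q)`, the splitting of the
# Bateman–Horn partial products of `f_d = x² + x + (1 − d)/4`, and their logarithms

Topic `Literature/Barriers/Parity`, companion ("Proofs"-type, theorems only) file of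
`SiegelZeroQuadraticPolynomials.lean`, first layer of the proof of
`Literature.Barriers.Parity.GranvilleMollin2000_prop2` (Granville–Mollin, *Rabinowitsch revisited*, Acta
Arith. 96 (2000), Proposition 2 and §8) from the named facts of
`Literature/NumberTheory/LFunctions/ExceptionalZeroPrimeSums.lean`. Everything here is PROVED and
elementary:

* `polyRootCountMod_rabinowitschPoly` — for `d = −q`, `q ≡ 3 (mod 4)`, and every prime `p`:
  `ω_{f_d}(p) = 1 + (p/q)` (Jacobi symbol; Granville–Mollin §5, first display with `a = 1`,
  `ω(p) = 1 + (d/p)`, and `(d/p) = (p/q)` by quadratic reciprocity; at `p = 2` by the second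
  supplement), via `x ↦ 2x + 1`: `4 f_d(x) = (2x+1)² − d`;
* `batemanHornPartial_rabinowitsch_eq` — `∏_{p ≤ X} (1 − 1/p)⁻¹ (1 − ω(p)/p)
  = (∏_{p ≤ X} (1 − 1/p)⁻¹) · ϱ_d · ∏_{√q < p ≤ X} (1 − ω(p)/p)` for `X ≥ ⌊√q⌋`;
* positivity of the factors for `q ≡ 3 (mod 8)` and vanishing (`ω(2) = 2`) for `q ≡ 7 (mod 8)`;
* `abs_sum_log_one_sub_omega_add_le` — `|∑_{√q < p ≤ X} (log(1 − ω(p)/p) + ω(p)/p)| ≤ 16/(⌊√q⌋+1)`.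

[cite: GranvilleMollin2000, §5 (first display) and §8]
-/

noncomputable section

open Finset Polynomial

namespace Literature.Barriers.Parity

/-! ### The local root count of `f_d` and the Jacobi symbol -/

/-- For an odd prime `p` and `d ≡ 1 (mod 4)`, `x ↦ 2x + 1` is a bijection between the roots of
`x² + x + (1 − d)/4` and the square roots of `d` in `ℤ/p` (`4 f_d(x) = (2x + 1)² − d`).
[folklore] -/
theorem card_filter_rabinowitsch_eq_card_sqrts {p : ℕ} [Fact p.Prime] (hp2 : p ≠ 2) {d : ℤ}
    (hd4 : d % 4 = 1) :
    #(univ.filter fun x : ZMod p => x ^ 2 + x + (((1 - d) / 4 : ℤ) : ZMod p) = 0) =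
      #(univ.filter fun y : ZMod p => y ^ 2 = (d : ZMod p)) := by
  have h2 : (2 : ZMod p) ≠ 0 := by
    intro h
    have h' : ((2 : ℕ) : ZMod p) = 0 := by exact_mod_cast h
    rw [ZMod.natCast_eq_zero_iff] at h'
    exact hp2 ((Nat.prime_dvd_prime_iff_eq (Fact.out : p.Prime) Nat.prime_two).mp h')
  set A : ZMod p := (((1 - d) / 4 : ℤ) : ZMod p) with hAdef
  have hA : (4 : ZMod p) * A = 1 - (d : ZMod p) := by
    have h4 : (4 : ℤ) * ((1 - d) / 4) = 1 - d := Int.mul_ediv_cancel' (by omega)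
    have := congrArg (fun z : ℤ => (z : ZMod p)) h4
    push_cast at this
    exact this
  set e : ZMod p := 2⁻¹ with he
  have h2e : 2 * e = 1 := mul_inv_cancel₀ h2
  refine Finset.card_nbij' (fun x => 2 * x + 1) (fun y => (y - 1) * e) ?_ ?_ ?_ ?_
  · intro x hx
    simp only [mem_coe, mem_filter, mem_univ, true_and] at hx ⊢
    linear_combination (4 : ZMod p) * hx - hA
  · intro y hy
    simp only [mem_coe, mem_filter, mem_univ, true_and] at hy ⊢
    linear_combination e ^ 2 * hy + e ^ 2 * hA + (-(e * y) + e - A * (2 * e + 1)) * h2e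
  · intro x _
    simp only
    linear_combination x * h2e
  · intro y _
    simp only
    linear_combination (y - 1) * h2e

/-- For an odd prime `p` and `d ≡ 1 (mod 4)`: `ω_{f_d}(p) = 1 + (d/p)` (Legendre symbol), the
number of roots of `x² + x + (1 − d)/4 (mod p)`. [cite: GranvilleMollin2000, §5 (first display)] -/
theorem polyRootCountMod_rabinowitschPoly_odd {p : ℕ} [Fact p.Prime] (hp2 : p ≠ 2) {d : ℤ}
    (hd4 : d % 4 = 1) :
    (Literature.NumberTheory.Sieve.polyRootCountMod ![rabinowitschPoly d] p : ℤ) = 1 + legendreSym p d := by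
  rw [Literature.NumberTheory.Sieve.polyRootCountMod_single_eq_card_zmod]
  have hset : (univ.filter fun x : ZMod p =>
      ((rabinowitschPoly d).map (Int.castRingHom (ZMod p))).eval x = 0) =
      univ.filter fun x : ZMod p => x ^ 2 + x + (((1 - d) / 4 : ℤ) : ZMod p) = 0 := by
    ext x
    simp [rabinowitschPoly]
  rw [hset, card_filter_rabinowitsch_eq_card_sqrts hp2 hd4, add_comm,
    ← legendreSym.card_sqrts p hp2 d]
  congr 2
  ext y
  simp

/-- `ω_{f_d}(2) = 2` if `d ≡ 1 (mod 8)` (all values of `n² + n + A`, `A` even, are even) and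
`ω_{f_d}(2) = 0` if `d ≡ 5 (mod 8)`. [folklore] -/
theorem polyRootCountMod_rabinowitschPoly_two {d : ℤ} (hd4 : d % 4 = 1) :
    Literature.NumberTheory.Sieve.polyRootCountMod ![rabinowitschPoly d] 2 = if d % 8 = 1 then 2 else 0 := by
  rw [Literature.NumberTheory.Sieve.polyRootCountMod_single]
  have h0 : ((2 : ℕ) : ℤ) ∣ (rabinowitschPoly d).eval ((0 : ℕ) : ℤ) ↔ d % 8 = 1 := by
    rw [rabinowitschPoly_eval]; push_cast; omega
  have h1 : ((2 : ℕ) : ℤ) ∣ (rabinowitschPoly d).eval ((1 : ℕ) : ℤ) ↔ d % 8 = 1 := by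
    rw [rabinowitschPoly_eval]; push_cast; omega
  rw [show range 2 = {0, 1} by decide, filter_insert, filter_singleton]
  by_cases h : d % 8 = 1
  · rw [if_pos (h0.mpr h), if_pos (h1.mpr h), if_pos h]; decide
  · rw [if_neg (fun h' => h (h0.mp h')), if_neg (fun h' => h (h1.mp h')), if_neg h]; rfl

/-- **`ω_{f_d}(p) = 1 + (p/q)`** for `d = −q`, `q ≡ 3 (mod 4)`, and every prime `p` (Jacobi
symbol `(p/q)`, which is the Kronecker symbol `(d/p)`: for odd `p` by quadratic reciprocity and
the first supplement, for `p = 2` by the second supplement `(2/q) = χ₈(q)`).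
[cite: GranvilleMollin2000, §5 (first display)] -/
theorem polyRootCountMod_rabinowitschPoly {d : ℤ} {q : ℕ} (hdq : d = -(q : ℤ)) (hq4 : q % 4 = 3)
    {p : ℕ} (hp : p.Prime) :
    (Literature.NumberTheory.Sieve.polyRootCountMod ![rabinowitschPoly d] p : ℤ) = 1 + jacobiSym p q := by
  have hd4 : d % 4 = 1 := by omega
  have hqodd : Odd q := Nat.odd_iff.mpr (by omega)
  rcases hp.eq_two_or_odd' with rfl | hpodd
  · -- `p = 2`
    rw [polyRootCountMod_rabinowitschPoly_two hd4, show ((2 : ℕ) : ℤ) = 2 from rfl,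
      jacobiSym.at_two hqodd, ZMod.χ₈_nat_eq_if_mod_eight]
    have hq2 : q % 2 ≠ 0 := by omega
    by_cases h8 : d % 8 = 1
    · have : q % 8 = 7 := by omega
      simp [h8, hq2, this]
    · have hq8 : q % 8 = 3 := by omega
      rw [if_neg h8, if_neg hq2, if_neg (by omega)]
      simp
  · haveI := Fact.mk hp
    have hp2 : p ≠ 2 := by have := Nat.odd_iff.mp hpodd; omega
    rw [polyRootCountMod_rabinowitschPoly_odd hp2 hd4, hdq, jacobiSym.legendreSym.to_jacobiSym,
      jacobiSym.neg _ hpodd]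
    congr 1
    -- `χ₄(p) · (q/p) = (p/q)` for `q ≡ 3 (mod 4)`
    rcases Nat.odd_mod_four_iff.mp (Nat.odd_iff.mp hpodd) with hp1 | hp3
    · rw [ZMod.χ₄_nat_one_mod_four hp1, one_mul]
      exact_mod_cast jacobiSym.quadratic_reciprocity_one_mod_four' hqodd hp1
    · rw [ZMod.χ₄_nat_three_mod_four hp3]
      have := jacobiSym.quadratic_reciprocity_three_mod_four hq4 hp3
      rw [this]
      ring

/-- `0 ≤ ω_{f_d}(p) ≤ 2` for every prime `p` (`d = −q`, `q ≡ 3 (mod 4)`). [folklore] -/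
theorem polyRootCountMod_rabinowitschPoly_le_two {d : ℤ} {q : ℕ} (hdq : d = -(q : ℤ))
    (hq4 : q % 4 = 3) {p : ℕ} (hp : p.Prime) : Literature.NumberTheory.Sieve.polyRootCountMod ![rabinowitschPoly d] p ≤ 2 := by
  have h := polyRootCountMod_rabinowitschPoly hdq hq4 hp
  rcases jacobiSym.trichotomy (p : ℤ) q with hJ | hJ | hJ <;> rw [hJ] at h <;> omega

/-- For `q ≡ 3 (mod 8)` (`d = −q ≡ 5 (mod 8)`): `ω_{f_d}(2) = 0`. [folklore] -/
theorem polyRootCountMod_rabinowitschPoly_two_eq_zero {d : ℤ} {q : ℕ} (hdq : d = -(q : ℤ))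
    (hq8 : q % 8 = 3) : Literature.NumberTheory.Sieve.polyRootCountMod ![rabinowitschPoly d] 2 = 0 := by
  rw [polyRootCountMod_rabinowitschPoly_two (by omega), if_neg (by omega)]

/-- For `q ≡ 7 (mod 8)` (`d = −q ≡ 1 (mod 8)`): `ω_{f_d}(2) = 2`. [folklore] -/
theorem polyRootCountMod_rabinowitschPoly_two_eq_two {d : ℤ} {q : ℕ} (hdq : d = -(q : ℤ))
    (hq8 : q % 8 = 7) : Literature.NumberTheory.Sieve.polyRootCountMod ![rabinowitschPoly d] 2 = 2 := by
  rw [polyRootCountMod_rabinowitschPoly_two (by omega), if_pos (by omega)]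

/-- For `q ≡ 3 (mod 8)` every Euler factor `1 − ω_{f_d}(p)/p` is positive (`ω(2) = 0`,
`ω(p) ≤ 2 < p` for odd `p`). [folklore] -/
theorem one_sub_omega_div_pos {d : ℤ} {q : ℕ} (hdq : d = -(q : ℤ)) (hq8 : q % 8 = 3) {p : ℕ}
    (hp : p.Prime) : 0 < 1 - (Literature.NumberTheory.Sieve.polyRootCountMod ![rabinowitschPoly d] p : ℝ) / p := by
  rcases hp.eq_two_or_odd' with rfl | hpodd
  · rw [polyRootCountMod_rabinowitschPoly_two_eq_zero hdq hq8]; norm_num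
  · have h2 := polyRootCountMod_rabinowitschPoly_le_two hdq (by omega) hp
    have hp3 : (3 : ℝ) ≤ p := by
      have := hp.two_le
      have h' : p ≠ 2 := by have := Nat.odd_iff.mp hpodd; omega
      exact_mod_cast (show 3 ≤ p by omega)
    have hω : (Literature.NumberTheory.Sieve.polyRootCountMod ![rabinowitschPoly d] p : ℝ) ≤ 2 := by exact_mod_cast h2
    rw [sub_pos, div_lt_one (by linarith)]
    linarith

/-! ### Splitting prime sums and products at a point -/

/-- `∑_{p ≤ X, s < p} g(p) = ∑_{p ≤ X} g(p) − ∑_{p ≤ s} g(p)` for `s ≤ X`. [folklore] -/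
theorem sum_primesLE_filter_lt {s X : ℕ} (h : s ≤ X) (g : ℕ → ℝ) :
    ∑ p ∈ (Nat.primesLE X).filter (fun p => s < p), g p =
      ∑ p ∈ Nat.primesLE X, g p - ∑ p ∈ Nat.primesLE s, g p := by
  have hsplit := sum_filter_add_sum_filter_not (Nat.primesLE X) (fun p => s < p) g
  have hnot : (Nat.primesLE X).filter (fun p => ¬ s < p) = Nat.primesLE s := by
    ext p
    simp only [mem_filter, Nat.mem_primesLE, not_lt]
    constructor
    · rintro ⟨⟨-, hp⟩, hps⟩; exact ⟨hps, hp⟩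
    · rintro ⟨hps, hp⟩; exact ⟨⟨hps.trans h, hp⟩, hps⟩
  rw [hnot] at hsplit
  linarith

/-- `∑_{p ≤ X, s < p} g(p) = ∑_{p ≤ m, s < p} g(p) + ∑_{p ≤ X, m < p} g(p)` for `s ≤ m ≤ X`.
[folklore] -/
theorem sum_primesLE_filter_lt_split {s m X : ℕ} (hsm : s ≤ m) (hmX : m ≤ X) (g : ℕ → ℝ) :
    ∑ p ∈ (Nat.primesLE X).filter (fun p => s < p), g p =
      ∑ p ∈ (Nat.primesLE m).filter (fun p => s < p), g p +
        ∑ p ∈ (Nat.primesLE X).filter (fun p => m < p), g p := by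
  rw [sum_primesLE_filter_lt (hsm.trans hmX), sum_primesLE_filter_lt hsm,
    sum_primesLE_filter_lt hmX]
  ring

/-- `∏_{p ≤ X} g(p) = (∏_{p ≤ s} g(p)) · ∏_{p ≤ X, s < p} g(p)` for `s ≤ X`. [folklore] -/
theorem prod_primesLE_eq_mul_prod_filter_lt {s X : ℕ} (h : s ≤ X) (g : ℕ → ℝ) :
    ∏ p ∈ Nat.primesLE X, g p =
      (∏ p ∈ Nat.primesLE s, g p) * ∏ p ∈ (Nat.primesLE X).filter (fun p => s < p), g p := by
  have hsplit := prod_filter_mul_prod_filter_not (Nat.primesLE X) (fun p => s < p) g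
  have hnot : (Nat.primesLE X).filter (fun p => ¬ s < p) = Nat.primesLE s := by
    ext p
    simp only [mem_filter, Nat.mem_primesLE, not_lt]
    constructor
    · rintro ⟨⟨-, hp⟩, hps⟩; exact ⟨hps, hp⟩
    · rintro ⟨hps, hp⟩; exact ⟨⟨hps.trans h, hp⟩, hps⟩
  rw [hnot] at hsplit
  rw [← hsplit, mul_comm]

/-- The primes of `(s, X]` lie in the integer interval `(s, X + 1)`. [folklore] -/
theorem primesLE_filter_lt_subset_Ioo (s X : ℕ) :
    (Nat.primesLE X).filter (fun p => s < p) ⊆ Ioo s (X + 1) := by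
  intro p hp
  rw [mem_filter, Nat.mem_primesLE] at hp
  rw [mem_Ioo]
  exact ⟨hp.2, Nat.lt_succ_of_le hp.1.1⟩

/-! ### The Bateman–Horn partial products of `f_d` -/

/-- For a single polynomial, `∏_{p ≤ X} (1 − 1/p)⁻¹ (1 − ω(p)/p) = (∏_{p ≤ X} (1 − 1/p)⁻¹) ·
∏_{p ≤ X} (1 − ω(p)/p)`. [folklore] -/
theorem batemanHornPartial_single (f : ℤ[X]) (X : ℕ) :
    Literature.NumberTheory.Sieve.batemanHornPartial ![f] X =
      (∏ p ∈ Nat.primesLE X, (1 - 1 / (p : ℝ))⁻¹) *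
        ∏ p ∈ Nat.primesLE X, (1 - (Literature.NumberTheory.Sieve.polyRootCountMod ![f] p : ℝ) / p) := by
  rw [Literature.NumberTheory.Sieve.batemanHornPartial, ← prod_mul_distrib]
  refine prod_congr rfl fun p _ => ?_
  simp

/-- `ϱ_d = ∏_{p ≤ ⌊√q⌋} (1 − ω_{f_d}(p)/p)` when `|d| = q`. [cite: GranvilleMollin2000, Theorem 4] -/
theorem gmRho_eq_prod {d : ℤ} {q : ℕ} (hq : (q : ℤ) = |d|) :
    gmRho d = ∏ p ∈ Nat.primesLE ⌊Real.sqrt q⌋₊,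
      (1 - (Literature.NumberTheory.Sieve.polyRootCountMod ![rabinowitschPoly d] p : ℝ) / p) := by
  have : |(d : ℝ)| = (q : ℝ) := by
    have h := congrArg (fun z : ℤ => (z : ℝ)) hq
    push_cast at h
    exact h.symm
  rw [gmRho, this]

/-- **Splitting of the partial product** at `√q`: for `X ≥ ⌊√q⌋`,
`∏_{p ≤ X} (1 − 1/p)⁻¹(1 − ω(p)/p) = (∏_{p ≤ X} (1 − 1/p)⁻¹) · ϱ_d · ∏_{⌊√q⌋ < p ≤ X} (1 − ω(p)/p)`.
[cite: GranvilleMollin2000, §8 (first display)] -/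
theorem batemanHornPartial_rabinowitsch_eq {d : ℤ} {q : ℕ} (hq : (q : ℤ) = |d|) {X : ℕ}
    (hX : ⌊Real.sqrt q⌋₊ ≤ X) :
    Literature.NumberTheory.Sieve.batemanHornPartial ![rabinowitschPoly d] X =
      (∏ p ∈ Nat.primesLE X, (1 - 1 / (p : ℝ))⁻¹) * (gmRho d *
        ∏ p ∈ (Nat.primesLE X).filter (fun p => ⌊Real.sqrt q⌋₊ < p),
          (1 - (Literature.NumberTheory.Sieve.polyRootCountMod ![rabinowitschPoly d] p : ℝ) / p)) := by
  rw [batemanHornPartial_single, gmRho_eq_prod hq, ← prod_primesLE_eq_mul_prod_filter_lt hX]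

/-- For `q ≡ 7 (mod 8)` (`ω(2) = 2`) the partial products vanish from `X = 2` on.
[folklore] -/
theorem batemanHornPartial_rabinowitsch_eq_zero {d : ℤ} {q : ℕ} (hdq : d = -(q : ℤ))
    (hq8 : q % 8 = 7) {X : ℕ} (hX : 2 ≤ X) : Literature.NumberTheory.Sieve.batemanHornPartial ![rabinowitschPoly d] X = 0 := by
  rw [batemanHornPartial_single]
  refine mul_eq_zero_of_right _ (prod_eq_zero (i := 2) ?_ ?_)
  · exact Nat.mem_primesLE.mpr ⟨hX, Nat.prime_two⟩
  · rw [polyRootCountMod_rabinowitschPoly_two_eq_two hdq hq8]; norm_num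

/-- For `q ≡ 7 (mod 8)` and `q ≥ 4`: `ϱ_d = 0`. [folklore] -/
theorem gmRho_eq_zero {d : ℤ} {q : ℕ} (hdq : d = -(q : ℤ)) (hq8 : q % 8 = 7) (hq4 : 4 ≤ q) :
    gmRho d = 0 := by
  have hq : (q : ℤ) = |d| := by rw [hdq, abs_neg, Nat.abs_cast]
  rw [gmRho_eq_prod hq]
  refine prod_eq_zero (i := 2) ?_ ?_
  · refine Nat.mem_primesLE.mpr ⟨Nat.le_floor ?_, Nat.prime_two⟩
    rw [show ((2 : ℕ) : ℝ) = Real.sqrt 4 by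
      rw [show (4 : ℝ) = 2 ^ 2 by norm_num, Real.sqrt_sq (by norm_num)]; norm_num]
    exact Real.sqrt_le_sqrt (by exact_mod_cast hq4)
  · rw [polyRootCountMod_rabinowitschPoly_two_eq_two hdq hq8]; norm_num

/-- For `q ≡ 3 (mod 8)`: `ϱ_d > 0`. [folklore] -/
theorem gmRho_pos {d : ℤ} {q : ℕ} (hdq : d = -(q : ℤ)) (hq8 : q % 8 = 3) : 0 < gmRho d := by
  have hq : (q : ℤ) = |d| := by rw [hdq, abs_neg, Nat.abs_cast]
  rw [gmRho_eq_prod hq]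
  exact prod_pos fun p hp => one_sub_omega_div_pos hdq hq8 (Nat.prime_of_mem_primesLE hp)

/-- For `q ≡ 3 (mod 8)` the partial products are positive. [folklore] -/
theorem batemanHornPartial_rabinowitsch_pos {d : ℤ} {q : ℕ} (hdq : d = -(q : ℤ))
    (hq8 : q % 8 = 3) (X : ℕ) : 0 < Literature.NumberTheory.Sieve.batemanHornPartial ![rabinowitschPoly d] X := by
  rw [batemanHornPartial_single]
  refine mul_pos (prod_pos fun p hp => ?_)
    (prod_pos fun p hp => one_sub_omega_div_pos hdq hq8 (Nat.prime_of_mem_primesLE hp))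
  have hp2 : (2 : ℝ) ≤ p := by exact_mod_cast (Nat.prime_of_mem_primesLE hp).two_le
  exact inv_pos.mpr (by rw [sub_pos, div_lt_one (by linarith)]; linarith)

/-- **Logarithm of the split product** (`q ≡ 3 (mod 8)`, `X ≥ ⌊√q⌋`):
`log ∏_{p ≤ X} (1 − 1/p)⁻¹(1 − ω(p)/p) = A(X) + log ϱ_d + ∑_{⌊√q⌋ < p ≤ X} log(1 − ω(p)/p)` with
`A(X) = ∑_{p ≤ X} −log(1 − 1/p)` the tree's `Literature.NumberTheory.LFunctions.Nicolas.mertensLog`.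
[cite: GranvilleMollin2000, §8 (first display)] -/
theorem log_batemanHornPartial_rabinowitsch {d : ℤ} {q : ℕ} (hdq : d = -(q : ℤ))
    (hq8 : q % 8 = 3) {X : ℕ} (hX : ⌊Real.sqrt q⌋₊ ≤ X) :
    Real.log (Literature.NumberTheory.Sieve.batemanHornPartial ![rabinowitschPoly d] X) =
      Literature.NumberTheory.LFunctions.Nicolas.mertensLog X + Real.log (gmRho d) +
        ∑ p ∈ (Nat.primesLE X).filter (fun p => ⌊Real.sqrt q⌋₊ < p),
          Real.log (1 - (Literature.NumberTheory.Sieve.polyRootCountMod ![rabinowitschPoly d] p : ℝ) / p) := by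
  have hq : (q : ℤ) = |d| := by rw [hdq, abs_neg, Nat.abs_cast]
  have hfac : ∀ p ∈ (Nat.primesLE X).filter (fun p => ⌊Real.sqrt q⌋₊ < p),
      (1 - (Literature.NumberTheory.Sieve.polyRootCountMod ![rabinowitschPoly d] p : ℝ) / p) ≠ 0 := fun p hp =>
    (one_sub_omega_div_pos hdq hq8 (Nat.prime_of_mem_primesLE (mem_filter.mp hp).1)).ne'
  have hM : ∀ p ∈ Nat.primesLE X, (1 - 1 / (p : ℝ))⁻¹ ≠ 0 := by
    intro p hp
    have hp2 : (2 : ℝ) ≤ p := by exact_mod_cast (Nat.prime_of_mem_primesLE hp).two_le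
    exact inv_ne_zero (by rw [sub_ne_zero, ne_comm, ne_eq, div_eq_one_iff_eq (by linarith)]; linarith)
  rw [batemanHornPartial_rabinowitsch_eq hq hX, Real.log_mul (prod_ne_zero_iff.mpr hM)
    (mul_ne_zero (gmRho_pos hdq hq8).ne' (prod_ne_zero_iff.mpr hfac)),
    Real.log_mul (gmRho_pos hdq hq8).ne' (prod_ne_zero_iff.mpr hfac), Real.log_prod hfac,
    Real.log_prod hM, Literature.NumberTheory.LFunctions.Nicolas.mertensLog_natCast, add_assoc]
  congr 1
  refine sum_congr rfl fun p _ => ?_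
  rw [Real.log_inv, one_div]

/-! ### The second-order terms `log(1 − ω(p)/p) + ω(p)/p` -/

/-- `|log(1 − ω(p)/p) + ω(p)/p| ≤ 8/p²` for a prime `p ≥ 5` (`ω(p) ≤ 2`). [folklore] -/
theorem abs_log_one_sub_omega_add_le {d : ℤ} {q : ℕ} (hdq : d = -(q : ℤ)) (hq4 : q % 4 = 3)
    {p : ℕ} (hp : p.Prime) (hp5 : 5 ≤ p) :
    |Real.log (1 - (Literature.NumberTheory.Sieve.polyRootCountMod ![rabinowitschPoly d] p : ℝ) / p) +
        (Literature.NumberTheory.Sieve.polyRootCountMod ![rabinowitschPoly d] p : ℝ) / p| ≤ 8 / (p : ℝ) ^ 2 := by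
  have hω : (Literature.NumberTheory.Sieve.polyRootCountMod ![rabinowitschPoly d] p : ℝ) ≤ 2 := by
    exact_mod_cast polyRootCountMod_rabinowitschPoly_le_two hdq hq4 hp
  have hω0 : (0 : ℝ) ≤ Literature.NumberTheory.Sieve.polyRootCountMod ![rabinowitschPoly d] p := Nat.cast_nonneg _
  have hp5' : (5 : ℝ) ≤ p := by exact_mod_cast hp5
  have hp0 : (0 : ℝ) < p := by linarith
  set u : ℝ := (Literature.NumberTheory.Sieve.polyRootCountMod ![rabinowitschPoly d] p : ℝ) / p with hu
  have hu0 : 0 ≤ u := div_nonneg hω0 hp0.le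
  have hu2 : u ≤ 2 / p := div_le_div_of_nonneg_right hω hp0.le
  have hu1 : u ≤ 1 / 2 := hu2.trans (by rw [div_le_iff₀ hp0]; linarith)
  calc |Real.log (1 - u) + u| ≤ 2 * u ^ 2 := Literature.NumberTheory.Sieve.abs_log_one_sub_add_le hu0 hu1
    _ ≤ 2 * (2 / p) ^ 2 := by gcongr
    _ = 8 / (p : ℝ) ^ 2 := by ring

/-- **The second-order terms are small**: for `4 ≤ s ≤ X`,
`|∑_{s < p ≤ X} (log(1 − ω(p)/p) + ω(p)/p)| ≤ 16/(s + 1)` (from `8/p²` per prime and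
`∑_{n > s} 1/n² ≤ 2/(s+1)`). [folklore] -/
theorem abs_sum_log_one_sub_omega_add_le {d : ℤ} {q : ℕ} (hdq : d = -(q : ℤ)) (hq4 : q % 4 = 3)
    {s X : ℕ} (hs : 4 ≤ s) :
    |∑ p ∈ (Nat.primesLE X).filter (fun p => s < p),
        (Real.log (1 - (Literature.NumberTheory.Sieve.polyRootCountMod ![rabinowitschPoly d] p : ℝ) / p) +
          (Literature.NumberTheory.Sieve.polyRootCountMod ![rabinowitschPoly d] p : ℝ) / p)| ≤ 16 / ((s : ℝ) + 1) := by
  calc |∑ p ∈ (Nat.primesLE X).filter (fun p => s < p),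
        (Real.log (1 - (Literature.NumberTheory.Sieve.polyRootCountMod ![rabinowitschPoly d] p : ℝ) / p) +
          (Literature.NumberTheory.Sieve.polyRootCountMod ![rabinowitschPoly d] p : ℝ) / p)|
      ≤ ∑ p ∈ (Nat.primesLE X).filter (fun p => s < p),
          |Real.log (1 - (Literature.NumberTheory.Sieve.polyRootCountMod ![rabinowitschPoly d] p : ℝ) / p) +
            (Literature.NumberTheory.Sieve.polyRootCountMod ![rabinowitschPoly d] p : ℝ) / p| := abs_sum_le_sum_abs _ _
    _ ≤ ∑ p ∈ (Nat.primesLE X).filter (fun p => s < p), 8 / (p : ℝ) ^ 2 := by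
        refine sum_le_sum fun p hp => ?_
        rw [mem_filter, Nat.mem_primesLE] at hp
        exact abs_log_one_sub_omega_add_le hdq hq4 hp.1.2 (by omega)
    _ ≤ ∑ n ∈ Ioo s (X + 1), 8 / (n : ℝ) ^ 2 :=
        sum_le_sum_of_subset_of_nonneg (primesLE_filter_lt_subset_Ioo s X)
          (fun n _ _ => by positivity)
    _ = 8 * ∑ n ∈ Ioo s (X + 1), ((n : ℝ) ^ 2)⁻¹ := by
        rw [mul_sum]; refine sum_congr rfl fun n _ => ?_; rw [div_eq_mul_inv]
    _ ≤ 8 * (2 / ((s : ℝ) + 1)) := by gcongr; exact sum_Ioo_inv_sq_le s (X + 1)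
    _ = 16 / ((s : ℝ) + 1) := by ring

end Literature.Barriers.Parity
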